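import Summits.QuantumFields.YangMills.Theorems.FemtoCutoffLadderOneSiteGapUpper

/-!
# Crux r3 `CoarsePairScaling` (stmt-QuantumFields-23866), registered skeleton `BirthR` — STUB `stub_oneSiteGapUpper` LANDED

Lead seat `ym-line-fcl-p1` (2026-08-28).  The registered stub `stub_oneSiteGapUpper : OneSiteGapUpper` of the skeleton
`Cruxes/CoarsePairScaling` (`ns …Cruxes.CoarsePairScaling.BirthR`; the skeleton's local `OneSiteGapUpper` is the verbatim body of the route
item stmt-QuantumFields-23944) is the reverse one-site law in window currency, closed in `FemtoCutoffLadderOneSiteGapUpper.lean`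
(`oneSiteGapUpper_proof`, p588467).  After this the skeleton has exactly ONE open stub: `stub_fixedLattice : FemtoGapFixedLattice` — the
tree's own fixed-lattice leaf (route item stmt-QuantumFields-23943), OPEN for `L ≥ 2`.

HONEST FRAMING: the `L = 1` three-matrix model only; R2b1 is a RECORD rung — not infinite volume, not a mass gap, not Clay.
No definitions, no named facts, no `sorry`.
-/

set_option autoImplicit false

namespace Summit.QuantumFields.YangMills.Cruxes.CoarsePairScaling.BirthR

open Summit.QuantumFields.YangMills.Theses.FemtoCutoffLadder

/-- ★ Registered stub `stub_oneSiteGapUpper` of crux r3's skeleton: the one-site gap UPPER bound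
`e^{−(ε₁Λ(β,1) + CΛ(β,1)²)}·λ₀(β,1) ≤ λ₁(β,1)` deep in the window (= route item `OneSiteGapUpper`, closed). [cite: Luscher1983, §2] -/
theorem stub_oneSiteGapUpper : OneSiteGapUpper :=
  Summit.QuantumFields.YangMills.Theorems.FemtoCutoffLadder.oneSiteGapUpper_proof

end Summit.QuantumFields.YangMills.Cruxes.CoarsePairScaling.BirthR
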